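import Summits.Ventures.YMGap.FlowData.TubeFluxNonAnnihilationAll
import Summits.Ventures.YMGap.FlowData.TubeTorelonEnvelope
import HarnessLib

/-!
# Venture YMGap, track Y3 FLOW-DATA — the quantitative multi-loop witness: `e^{−|J| n P} c₀^{N−|e|L} λ^{|e|L} ≤ ‖T ∘ P_e‖`
# for every centre flux `e` (general compact group; theorems only)

HONEST FRAMING: venture file of the cell `pub-ymgap` (QuantumFields programme), track Y3; the quantitative form of
`FlowData/TubeFluxNonAnnihilationAll.lean` (which proved `0 < ‖T ∘ P_e‖`), preparing the strong-coupling window of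
every flux energy (`FlowData/TubeFluxEnergyWindow.lean`).  Finite spatial torus `(ℤ/L)^k`, compact group, continuous
unitary `ρ` with `ρ(z) = −1`, `z` central; no number, no row, nothing about limits or a mass gap.

* `tubeSectorNorm_ge_of_pathState` — a gauge-invariant path trace on `m` distinct links with twist eigenvalues `χ_e`
  gives `e^{−|J| n P} c₀^{N−m} λ^m ≤ ‖T ∘ P_e‖` (`c₀ = ∫ e^{J Re tr ρ}`, `λ` the Schur scalar, `N` links, `P` plaquettes);
* `exists_enum_support_card`, `card_support_mul_le_card_edge` — every flux label is the indicator of `|e|` distinct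
  directions (`|e| = (univ.filter (e · = 1)).card`), and `|e|·L ≤ N`;
* **`tubeSectorNorm_ge`** — `e^{−|J| n P} c₀^{N−|e|L} λ^{|e|L} ≤ ‖T ∘ P_e‖` for EVERY `e` (the staircase path winding once
  along each direction of the support; the empty path for `|e| = 0`).

References: G. 't Hooft, Nucl. Phys. B 153 (1979) 141 [cite: tHooft1979Flux]; I. Montvay, G. Münster (1994) §3.2.6
[cite: MontvayMunster1994, §3.2.6].
-/

noncomputable section

open scoped BigOperators
open MeasureTheory Filter Function
open Literature.MathematicalPhysics.QuantumFieldTheory Literature.Analysis.OperatorTheory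
open Literature.Barriers.QuantumFields

namespace Summit.Ventures.YMGap.FlowData

/-! ### The quantitative multi-loop witness (general compact group) -/

section PathState

variable {G : Type*} [Group G] [TopologicalSpace G] [IsTopologicalGroup G] [CompactSpace G]
  [MeasurableSpace G] [BorelSpace G] [SecondCountableTopology G] {n : ℕ} (ρ : G →* Matrix (Fin n) (Fin n) ℂ)
  (J : ℝ) {k L : ℕ} [NeZero L]

/-- **Quantitative path-state witness**: a gauge-invariant holonomy trace along `m` distinct links with twist
eigenvalues `χ_e(s)` gives `e^{−|J| n P} c₀^{N−m} λ^m ≤ ‖T ∘ P_e‖` (`c₀ = ∫ e^{J Re tr ρ}`, `λ` the Schur scalar,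
`N` links, `P` plaquettes; unitary continuous `ρ`, `n ≠ 0`, `z` central). [cite: tHooft1979Flux] [cite: MontvayMunster1994, §3.2.6] -/
theorem tubeSectorNorm_ge_of_pathState (hρ : Continuous ρ) (hρu : ∀ g, ρ g ∈ Matrix.unitaryGroup (Fin n) ℂ) (hn : n ≠ 0)
    {z : G} (hz : z ∈ Subgroup.center G) {lam : ℝ}
    (hM : ∀ i j, ∫ c, (Real.exp (J * (ρ c).trace.re) : ℂ) * ρ c i j ∂haarProbability G = if i = j then (lam : ℂ) else 0)
    {m : ℕ} (ℓ : Fin m → Edge k L) (hℓ : Injective ℓ) (e : Fin k → ZMod 2)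
    (hWg : ∀ (γ : Site k L → G) (b : GaugeConfig k L G),
      (ρ ((List.ofFn fun t : Fin m => gaugeTransform γ b (ℓ t)).prod)).trace.re =
        (ρ ((List.ofFn fun t : Fin m => b (ℓ t)).prod)).trace.re)
    (hWs : ∀ (s : Fin k → ZMod 2) (b : GaugeConfig k L G),
      (ρ ((List.ofFn fun t : Fin m => fluxTwist z s b (ℓ t)).prod)).trace.re =
        fluxSign e s * (ρ ((List.ofFn fun t : Fin m => b (ℓ t)).prod)).trace.re) :
    Real.exp (-(|J| * (n * Fintype.card (Plaquette k L)))) *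
        ((∫ g, Real.exp (J * (ρ g).trace.re) ∂haarProbability G) ^ (Fintype.card (Edge k L) - m) * lam ^ m) ≤
      tubeSectorNorm ρ z J k L e := by
  set W : GaugeConfig k L G → ℝ := fun b => (ρ ((List.ofFn fun t : Fin m => b (ℓ t)).prod)).trace.re with hW
  set f : GaugeConfig k L G → ℝ := fun b => Real.exp (-(J / 2 * magSum (d := k) (L := L) ρ b)) * W b with hf
  set P : ℝ := n * Fintype.card (Plaquette k L) with hP
  have hWc : Continuous W :=
    Complex.continuous_re.comp ((hρ.comp (continuous_prod_ofFn_apply m ℓ)).matrix_trace)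
  have hfc : Continuous f :=
    (Real.continuous_exp.comp (continuous_const.mul (continuous_magSum (d := k) (L := L) ρ hρ)).neg).mul hWc
  obtain ⟨Cf, hCf⟩ := isCompact_univ.exists_bound_of_continuousOn hfc.continuousOn
  have hmem : MemLp f 2 (sliceMeasure G k L) :=
    MemLp.of_bound hfc.aestronglyMeasurable Cf (Eventually.of_forall fun b => hCf b (Set.mem_univ _))
  have heig : ∀ s : Fin k → ZMod 2, fluxTwistOp k L z s (hmem.toLp f) = fluxSign e s • hmem.toLp f := by
    intro s
    refine fluxTwistOp_toLp_eq_smul z s hmem _ fun b => ?_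
    have hWs' : W (fluxTwist z s b) = fluxSign e s * W b := by simp only [hW]; exact hWs s b
    simp only [hf]
    rw [magSum_fluxTwist ρ hz, hWs']
    ring
  have hP1 : tubeFluxProjection z k L e (hmem.toLp f) = hmem.toLp f :=
    tubeFluxProjection_apply_of_twist_eigen z heig
  have hinner := inner_tubeTransferOperator_pathState ρ J hρ hM ℓ hℓ hWg hmem
  have hW2i : Integrable (fun b => W b ^ 2) (sliceMeasure G k L) :=
    (hWc.pow 2).integrable_of_hasCompactSupport (HasCompactSupport.of_compactSpace _)
  have hnorm : ‖hmem.toLp f‖ ^ 2 ≤ Real.exp (|J| * P) * ∫ b, W b ^ 2 ∂(sliceMeasure G k L) := by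
    rw [norm_sq_eq_integral_sq, ← integral_const_mul]
    have hae := hmem.coeFn_toLp
    refine integral_mono_ae ((Lp.memLp (hmem.toLp f)).integrable_sq) (hW2i.const_mul _) ?_
    filter_upwards [hae] with b hb
    rw [hb]
    simp only [hf]
    rw [mul_pow, ← Real.exp_nat_mul]
    have h2 : ((2 : ℕ) : ℝ) * -(J / 2 * magSum (d := k) (L := L) ρ b) = -(J * magSum (d := k) (L := L) ρ b) := by
      push_cast; ring
    rw [h2]
    exact mul_le_mul_of_nonneg_right (exp_neg_magSum_le ρ J hρu b) (sq_nonneg _)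
  have hle : (∫ g, Real.exp (J * (ρ g).trace.re) ∂haarProbability G) ^ (Fintype.card (Edge k L) - m) * lam ^ m *
      ∫ b, W b ^ 2 ∂(sliceMeasure G k L) ≤ tubeSectorNorm ρ z J k L e * ‖hmem.toLp f‖ ^ 2 := by
    rw [← hinner]
    have h := real_inner_le_norm (hmem.toLp f)
      (((tubeTransferOperator ρ J k L).comp (tubeFluxProjection z k L e)) (hmem.toLp f))
    rw [ContinuousLinearMap.comp_apply, hP1] at h
    refine h.trans ?_
    have h2 := ((tubeTransferOperator ρ J k L).comp (tubeFluxProjection z k L e)).le_opNorm (hmem.toLp f)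
    rw [ContinuousLinearMap.comp_apply, hP1] at h2
    unfold tubeSectorNorm sectorNorm
    calc ‖hmem.toLp f‖ * ‖tubeTransferOperator ρ J k L (hmem.toLp f)‖
        ≤ ‖hmem.toLp f‖ * (‖(tubeTransferOperator ρ J k L).comp (tubeFluxProjection z k L e)‖ * ‖hmem.toLp f‖) :=
          mul_le_mul_of_nonneg_left h2 (norm_nonneg _)
      _ = ‖(tubeTransferOperator ρ J k L).comp (tubeFluxProjection z k L e)‖ * ‖hmem.toLp f‖ ^ 2 := by ring
  have hS0 : 0 ≤ tubeSectorNorm ρ z J k L e := sectorNorm_nonneg _ _ _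
  have h3 : (∫ g, Real.exp (J * (ρ g).trace.re) ∂haarProbability G) ^ (Fintype.card (Edge k L) - m) * lam ^ m *
      ∫ b, W b ^ 2 ∂(sliceMeasure G k L) ≤
      tubeSectorNorm ρ z J k L e * (Real.exp (|J| * P) * ∫ b, W b ^ 2 ∂(sliceMeasure G k L)) :=
    hle.trans (mul_le_mul_of_nonneg_left hnorm hS0)
  have hW1 : W 1 = n := by
    have h : (List.ofFn fun t : Fin m => (1 : GaugeConfig k L G) (ℓ t)).prod = 1 := by
      simp only [Pi.one_apply, List.ofFn_const, List.prod_replicate, one_pow]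
    simp only [hW, h, map_one, Matrix.trace_one, Fintype.card_fin, Complex.natCast_re]
  have hW2pos : 0 < ∫ b, W b ^ 2 ∂(sliceMeasure G k L) :=
    Continuous.integral_pos_of_hasCompactSupport_nonneg_nonzero (x := 1) (hWc.pow 2)
      (HasCompactSupport.of_compactSpace _) (fun b => sq_nonneg _)
      (by rw [hW1]; exact pow_ne_zero 2 (Nat.cast_ne_zero.2 hn))
  have hexp : 0 < Real.exp (|J| * P) := Real.exp_pos _
  have h4 : (∫ g, Real.exp (J * (ρ g).trace.re) ∂haarProbability G) ^ (Fintype.card (Edge k L) - m) * lam ^ m ≤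
      tubeSectorNorm ρ z J k L e * Real.exp (|J| * P) :=
    le_of_mul_le_mul_right (by nlinarith [h3]) hW2pos
  rw [Real.exp_neg]
  calc (Real.exp (|J| * P))⁻¹ *
        ((∫ g, Real.exp (J * (ρ g).trace.re) ∂haarProbability G) ^ (Fintype.card (Edge k L) - m) * lam ^ m)
      ≤ (Real.exp (|J| * P))⁻¹ * (tubeSectorNorm ρ z J k L e * Real.exp (|J| * P)) :=
        mul_le_mul_of_nonneg_left h4 (inv_nonneg.2 hexp.le)
    _ = tubeSectorNorm ρ z J k L e := by field_simp

omit [TopologicalSpace G] [IsTopologicalGroup G] [CompactSpace G] [MeasurableSpace G] [BorelSpace G]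
  [SecondCountableTopology G] [NeZero L] in
/-- Every flux label is the indicator of an enumeration of its support by `|e|` distinct directions (`k ≥ 1`).
[folklore] -/
theorem exists_enum_support_card [Nonempty (Fin k)] (e : Fin k → ZMod 2) :
    ∃ (ds : ℕ → Fin k), (∀ q q', q < (Finset.univ.filter fun ν => e ν = 1).card →
        q' < (Finset.univ.filter fun ν => e ν = 1).card → ds q = ds q' → q = q') ∧
      ∀ ν, e ν = 1 ↔ ∃ q, q < (Finset.univ.filter fun ν => e ν = 1).card ∧ ds q = ν := by
  classical
  set S : Finset (Fin k) := Finset.univ.filter fun ν => e ν = 1 with hSdef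
  have hS : ∀ ν, ν ∈ S ↔ e ν = 1 := fun ν => by simp [hSdef]
  obtain ⟨μ₀⟩ : Nonempty (Fin k) := inferInstance
  refine ⟨fun q => if h : q < S.card then (S.equivFin.symm ⟨q, h⟩ : Fin k) else μ₀, ?_, fun ν => ?_⟩
  · intro q q' hq hq' h
    simp only [hq, hq', dif_pos] at h
    have := S.equivFin.symm.injective (Subtype.ext h)
    exact Fin.mk.inj_iff.1 this
  · constructor
    · intro h1
      have hν : ν ∈ S := (hS ν).2 h1
      refine ⟨(S.equivFin ⟨ν, hν⟩ : ℕ), (S.equivFin ⟨ν, hν⟩).2, ?_⟩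
      simp only [(S.equivFin ⟨ν, hν⟩).2, dif_pos, Fin.eta, Equiv.symm_apply_apply]
    · rintro ⟨q, hq, rfl⟩
      simp only [hq, dif_pos]
      exact (hS _).1 (S.equivFin.symm ⟨q, hq⟩).2

omit [TopologicalSpace G] [IsTopologicalGroup G] [CompactSpace G] [MeasurableSpace G] [BorelSpace G]
  [SecondCountableTopology G] in
/-- With no spatial direction every flux label has empty support. [folklore] -/
theorem card_support_eq_zero_of_isEmpty [IsEmpty (Fin k)] (e : Fin k → ZMod 2) :
    (Finset.univ.filter fun ν => e ν = 1).card = 0 := by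
  rw [Finset.card_eq_zero, Finset.filter_eq_empty_iff]
  intro ν _
  exact isEmptyElim ν

/-- `|e| · L ≤ N`: the staircase path of the support has `|e|·L` distinct links. [folklore] -/
theorem card_support_mul_le_card_edge (e : Fin k → ZMod 2) :
    (Finset.univ.filter fun ν => e ν = 1).card * L ≤ Fintype.card (Edge k L) := by
  rcases isEmpty_or_nonempty (Fin k) with hk | hk
  · rw [card_support_eq_zero_of_isEmpty, zero_mul]; exact Nat.zero_le _
  · obtain ⟨ds, hds, -⟩ := exists_enum_support_card (k := k) e
    have h := Fintype.card_le_of_injective _ (blockPath_injective (k := k) (L := L) _ ds hds)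
    rwa [Fintype.card_fin] at h

/-- **`e^{−|J| n P} c₀^{N−|e|L} λ^{|e|L} ≤ ‖T ∘ P_e‖`** for every flux `e` (the staircase path along the support;
`ρ(z) = −1`, `z` central, unitary continuous `ρ`, `n ≠ 0`). [cite: tHooft1979Flux] -/
theorem tubeSectorNorm_ge (hρ : Continuous ρ) (hρu : ∀ g, ρ g ∈ Matrix.unitaryGroup (Fin n) ℂ) (hn : n ≠ 0)
    {z : G} (hz : z ∈ Subgroup.center G) (hρz : ρ z = -1) {lam : ℝ}
    (hM : ∀ i j, ∫ c, (Real.exp (J * (ρ c).trace.re) : ℂ) * ρ c i j ∂haarProbability G = if i = j then (lam : ℂ) else 0)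
    (e : Fin k → ZMod 2) :
    Real.exp (-(|J| * (n * Fintype.card (Plaquette k L)))) *
        ((∫ g, Real.exp (J * (ρ g).trace.re) ∂haarProbability G) ^
            (Fintype.card (Edge k L) - (Finset.univ.filter fun ν => e ν = 1).card * L) *
          lam ^ ((Finset.univ.filter fun ν => e ν = 1).card * L)) ≤
      tubeSectorNorm ρ z J k L e := by
  rcases isEmpty_or_nonempty (Fin k) with hk | hk
  · -- no spatial direction: the empty path
    have hsign : ∀ s : Fin k → ZMod 2, fluxSign e s = 1 := fun s => by
      unfold fluxSign
      exact Finset.prod_eq_one fun μ _ => isEmptyElim μ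
    rw [card_support_eq_zero_of_isEmpty, zero_mul]
    exact tubeSectorNorm_ge_of_pathState ρ J hρ hρu hn hz hM (Fin.elim0 : Fin 0 → Edge k L)
      (fun t => Fin.elim0 t) e (fun γ b => by simp only [List.ofFn_zero])
      (fun s b => by rw [hsign, one_mul]; simp only [List.ofFn_zero])
  · obtain ⟨ds, hds, hsupp⟩ := exists_enum_support_card (k := k) e
    exact tubeSectorNorm_ge_of_pathState ρ J hρ hρu hn hz hM
      (fun t : Fin ((Finset.univ.filter fun ν => e ν = 1).card * L) =>
        (Pi.single (ds ((t : ℕ) / L)) ((((t : ℕ) % L : ℕ)) : ZMod L), ds ((t : ℕ) / L)))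
      (blockPath_injective _ ds hds) e
      (fun γ b => by
        rw [blockPath_prod_gaugeTransform, map_mul, map_mul, Matrix.trace_mul_cycle, ← map_mul, inv_mul_cancel, map_one,
          one_mul])
      (blockPath_trace_fluxTwist ρ hz hρz _ ds hds e hsupp)

end PathState

end Summit.Ventures.YMGap.FlowData
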